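import Summits.BirchSwinnertonDyer.Rank1Residual.Additive.RamifiedTwistTamagawa
import Summits.BirchSwinnertonDyer.Rank1Residual.Additive.X3RankZeroSemistableTwistAnyOdd
import Summits.BirchSwinnertonDyer.Rank1Residual.Additive.X4RankZeroSemistableTwistOdd
import Literature.NumberTheory.EllipticCurves.Rank1Residual.Typed.CasselsLowerBound
import HarnessLib

/-!
# V9/V9b odd assemblies WITHOUT the per-pair Tamagawa bit: `p ∤ c_p(E)` is a theorem for `E ≅ V^{(±p)}` (cell `b2b-bsdres`, seat additive-p4, lines V9/V9b/V9d)

HONEST FRAMING (cell `b2b-bsdres`, run/shared/lean/b2b/bsd-rank1-residual/, verbatim in every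
file): the goal of the cell is to DELETE the COMBINATION-SHAPED residual classes of the
Birch–Swinnerton-Dyer formula for ALL analytic-rank `≤ 1` elliptic curves over `ℚ` — "full BSD
formula for every rank `≤ 1` curve in class `C`" assembled STRICTLY from published theorems — so
that the rank-`≤ 1` remainder becomes exactly the CONSTRUCTION-SHAPED classes, which are TYPED
(missing-input `Prop`s), NOT attempted. This is not "finishing BSD". The additive sub-cell (seats
additive-p1…p4) is a RESEARCH ROUTE on the construction-shaped classes X3/X4; no claim beyond the
stated classes; the labels of X3/X4 are UNCHANGED.

Theorems only (no definition, no named fact). The odd-parity (`p ≡ 3 (mod 4)`, in the census `p = 3`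
and `p = 7`) V9 assembly `X3RankZeroTwistOdd.*` (p203966), the glued statement for every odd prime
`X3RankZeroTwist.*_of_odd_prime` (p204799) and the X4 big-image twin `X4RankZeroTwistOdd.*`
(p204500) concluded `ord_p #Ш(E) ≤ ord_p #Ш_an(E) + ord_p c_p(E)` and needed the per-pair census bit
`htam : p ∤ c_p(E)` (binding only at `p = 3`) for `Typed.MissingUpperBoundAt`. That bit is now the
tree theorem `not_dvd_tamagawaNumberAt_twist_pm_p` (`Additive/RamifiedTwistTamagawa.lean`: the twist
of a `p`-semistable curve by `±p` has Kodaira type `I₀*`/`Iₙ*`, so `c_p ∈ {1, 2, 4}`), and this file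
records the resulting statements with `htam` DISCHARGED — same inputs otherwise: Delbourgo 1998
Prop. 4 (`hDel`, named fact p202678), Gross–Zagier–Kolyvagin (`hGZK`), modularity (`hmod`) and the
ONE typed input of the line ([B∘C](0): `ChiBranchLeadingTermOddAt` for X3, Kato-shaped
`ChiBranchLeadingTermOddBigImageAt` for X4; for the glued statement also the even
`ChiBranchLeadingTermAt`):

* `X3RankZeroTwistOdd.padicValNat_shaOrder_le_shaAn` — **`ord_p #Ш(E) ≤ ord_p #Ш_an(E)`** on
  X3 ∧ `r_an = 0` ∧ (`E ≅ V^{(−p)}`, `V` good ordinary or multiplicative at `p`) ∧ `p ≡ 3 (mod 4)`;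
  `X3RankZeroTwistOdd.missingUpperBoundAt_of_semistableTwist` (`Typed.MissingUpperBoundAt`),
  `X3RankZeroTwistOdd.bsdp_of_semistableTwist_of_shaAn_unit` (**`BSD(E,p)` on the `p ∤ #Ш_an` rows,
  `p = 3` included**), `X3RankZeroTwistOdd.missingPPartAt_iff_lower_of_semistableTwist`;
* `X4RankZeroTwistOdd.padicValNat_shaOrder_le_shaAn`, `.missingUpperBoundAt_of_semistableTwist`,
  `.bsdp_of_semistableTwist_of_shaAn_unit`, `.missingPPartAt_iff_lower_of_semistableTwist` — the same
  on X4 with `ρ_{V,p^∞}` surjective (the "≤" half of X4♯(3) on the semistable-twist rows, now with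
  NO per-pair Tamagawa bit);
* `X3RankZeroTwist.padicValNat_shaOrder_le_shaAn_of_odd_prime`,
  `.missingUpperBoundAt_of_odd_prime_of_semistableTwist`,
  `.bsdp_of_odd_prime_of_semistableTwist_of_shaAn_unit` — every odd prime, both parities glued.

* `X3RankZeroTwistOdd.bsdp_of_semistableTwist_of_casselsTate_of_pow_dvd` (and the X4 twin) — on the
  `p ∣ #Ш_an` rows (`ord_p #Ш_an ≤ 2k`): `BSD(E,p)` from the finite certificate `p^{2k−1} ∣ #Ш(E)`
  (`k = 1`: `Ш(E)[p] ≠ 0`) by Cassels–Tate squareness (`Typed/CasselsLowerBound.lean`); census: the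
  5 rank-0 V9 rows `7632m1, 8190bz1, 13860x1, 15138i1, 19530cg1` at `p = 3` (`#Ш_an = 9`).

Net per-pair data still needed on a rank-0 V9 row: `p ∤ #Ш_an(E)` (or, if `p² ‖ #Ш_an`, a
`p`-descent certificate `Ш(E)[p] ≠ 0`); the class statement `MissingUpperBoundAt` needs none. References: [Delbourgo1998] Thm. 3, Prop. 4;
[SilvermanATAEC1994] IV.9.4 Steps 6–7; [Miller2011LMS] (`BSD(E,p)`).
-/

noncomputable section

open scoped Classical MatrixGroups ModularForm

open CongruenceSubgroup WeierstrassCurve Literature.NumberTheory.EllipticCurves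
  Literature.NumberTheory.EllipticCurves.ModularForms
  Literature.NumberTheory.EllipticCurves.Rank1Residual

namespace Summit.BirchSwinnertonDyer.Rank1Residual.Additive

open IsDedekindDomain NumberField Rat.HeightOneSpectrum
  Literature.NumberTheory.EllipticCurves.Rank1Residual.Typed

variable (W : WeierstrassCurve ℚ) [W.IsElliptic] [W.IsGloballyMinimal] (p : ℕ) [hp : Fact p.Prime]

/-! ## X3, `p ≡ 3 (mod 4)` -/

section X3Odd

/-- **`ord_p #Ш(E) ≤ ord_p #Ш_an(E)` on X3 ∧ `r_an = 0` ∧ (semistable twist), `p ≡ 3 (mod 4)`,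
`p = 3` INCLUDED**, granted [B∘C](0) (odd branch): `#Ш_an(E) = q ∈ ℚ` with `ord_p #Ш(E) ≤ ord_p q`.
The Tamagawa term of `X3RankZeroTwistOdd.shaOrder_le` vanishes by
`not_dvd_tamagawaNumberAt_twist_pm_p` (`c_p(E) ∈ {1, 2, 4}`). -/
theorem X3RankZeroTwistOdd.padicValNat_shaOrder_le_shaAn
    (hDel : Delbourgo1998.prop4_rankZero_pow_dvd_constantCoeff)
    (hGZK : rank_eq_analyticRank_of_analyticRank_le_one) (hmod : hasEntireLFunction_rat)
    (hBC : ChiBranchLeadingTermOddAt W p)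
    (hp4 : p % 4 = 3) (hr : W.analyticRank = 0) (hX : ClassX3 W p)
    (V : WeierstrassCurve ℚ) [V.IsElliptic] [V.IsGloballyMinimal]
    (C : VariableChange ℚ) (hC : C • V.quadraticTwist (-(p : ℚ)) = W) (hV : GoodOrd V p ∨ Mult V p)
    {N : ℕ} [NeZero N] {f : CuspForm (Gamma0 N) 2} (hf : IsNewformOf V f)
    (ϖ : ℚ) (hϖ : (ϖ : ℝ) * V.imaginaryPeriodRat = minusPeriod f) :
    ∃ q : ℚ, shaAn W = (q : ℂ) ∧ (padicValNat p W.shaOrder : ℤ) ≤ padicValRat p q := by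
  obtain ⟨q, hq, hle⟩ :=
    X3RankZeroTwistOdd.shaOrder_le W p hDel hGZK hmod hBC hp4 hr hX V C hC hV hf ϖ hϖ
  have htam := not_dvd_tamagawaNumberAt_twist_pm_p p (by omega) V
    (hV.elim (fun h ↦ Or.inl h.1) Or.inr) (d := -(p : ℚ)) (Or.inr rfl) C hC
  refine ⟨q, hq, ?_⟩
  rw [padicValNat.eq_zero_of_not_dvd htam, Nat.cast_zero, add_zero] at hle
  exact hle

/-- **`Typed.MissingUpperBoundAt W p` on X3 ∧ `r_an = 0` ∧ (semistable twist) at every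
`p ≡ 3 (mod 4)`** (no Tamagawa hypothesis), granted [B∘C](0) (odd branch). -/
theorem X3RankZeroTwistOdd.missingUpperBoundAt_of_semistableTwist
    (hDel : Delbourgo1998.prop4_rankZero_pow_dvd_constantCoeff)
    (hGZK : rank_eq_analyticRank_of_analyticRank_le_one) (hmod : hasEntireLFunction_rat)
    (hBC : ChiBranchLeadingTermOddAt W p)
    (hp4 : p % 4 = 3) (hr : W.analyticRank = 0) (hX : ClassX3 W p)
    (V : WeierstrassCurve ℚ) [V.IsElliptic] [V.IsGloballyMinimal]
    (C : VariableChange ℚ) (hC : C • V.quadraticTwist (-(p : ℚ)) = W) (hV : GoodOrd V p ∨ Mult V p)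
    {N : ℕ} [NeZero N] {f : CuspForm (Gamma0 N) 2} (hf : IsNewformOf V f)
    (ϖ : ℚ) (hϖ : (ϖ : ℝ) * V.imaginaryPeriodRat = minusPeriod f) :
    MissingUpperBoundAt W p :=
  X3RankZeroTwistOdd.missingUpperBoundAt W p hDel hGZK hmod hBC hp4 hr hX V C hC hV hf ϖ hϖ
    (not_dvd_tamagawaNumberAt_twist_pm_p p (by omega) V (hV.elim (fun h ↦ Or.inl h.1) Or.inr)
      (d := -(p : ℚ)) (Or.inr rfl) C hC)

/-- **`BSD(E,p)` on the `p ∤ #Ш_an(E)` rows of X3 ∧ `r_an = 0` ∧ (semistable twist),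
`p ≡ 3 (mod 4)` — `BSD(E,3)` included** — granted [B∘C](0) (odd branch); the only per-pair datum
left is `p ∤ #Ш_an(E)`. -/
theorem X3RankZeroTwistOdd.bsdp_of_semistableTwist_of_shaAn_unit
    (hDel : Delbourgo1998.prop4_rankZero_pow_dvd_constantCoeff)
    (hGZK : rank_eq_analyticRank_of_analyticRank_le_one) (hmod : hasEntireLFunction_rat)
    (hBC : ChiBranchLeadingTermOddAt W p)
    (hp4 : p % 4 = 3) (hr : W.analyticRank = 0) (hX : ClassX3 W p)
    (V : WeierstrassCurve ℚ) [V.IsElliptic] [V.IsGloballyMinimal]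
    (C : VariableChange ℚ) (hC : C • V.quadraticTwist (-(p : ℚ)) = W) (hV : GoodOrd V p ∨ Mult V p)
    {N : ℕ} [NeZero N] {f : CuspForm (Gamma0 N) 2} (hf : IsNewformOf V f)
    (ϖ : ℚ) (hϖ : (ϖ : ℝ) * V.imaginaryPeriodRat = minusPeriod f)
    {q : ℚ} (hq : shaAn W = (q : ℂ)) (hv : padicValRat p q = 0) : BSDp W p :=
  X3RankZeroTwistOdd.bsdp_of_shaAn_unit W p hDel hGZK hmod hBC hp4 hr hX V C hC hV hf ϖ hϖ
    (not_dvd_tamagawaNumberAt_twist_pm_p p (by omega) V (hV.elim (fun h ↦ Or.inl h.1) Or.inr)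
      (d := -(p : ℚ)) (Or.inr rfl) C hC) hq hv

/-- **What remains of X3♯ on these pairs is exactly the LOWER half** (`p ≡ 3 (mod 4)`, no Tamagawa
hypothesis), granted [B∘C](0): `Typed.X3.MissingInputAt W p ⟺ MissingLowerBoundAt W p`. -/
theorem X3RankZeroTwistOdd.missingPPartAt_iff_lower_of_semistableTwist
    (hDel : Delbourgo1998.prop4_rankZero_pow_dvd_constantCoeff)
    (hGZK : rank_eq_analyticRank_of_analyticRank_le_one) (hmod : hasEntireLFunction_rat)
    (hBC : ChiBranchLeadingTermOddAt W p)
    (hp4 : p % 4 = 3) (hr : W.analyticRank = 0) (hX : ClassX3 W p)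
    (V : WeierstrassCurve ℚ) [V.IsElliptic] [V.IsGloballyMinimal]
    (C : VariableChange ℚ) (hC : C • V.quadraticTwist (-(p : ℚ)) = W) (hV : GoodOrd V p ∨ Mult V p)
    {N : ℕ} [NeZero N] {f : CuspForm (Gamma0 N) 2} (hf : IsNewformOf V f)
    (ϖ : ℚ) (hϖ : (ϖ : ℝ) * V.imaginaryPeriodRat = minusPeriod f) :
    X3.MissingInputAt W p ↔ MissingLowerBoundAt W p :=
  X3RankZeroTwistOdd.missingPPartAt_iff_lower W p hDel hGZK hmod hBC hp4 hr hX V C hC hV hf ϖ hϖ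
    (not_dvd_tamagawaNumberAt_twist_pm_p p (by omega) V (hV.elim (fun h ↦ Or.inl h.1) Or.inr)
      (d := -(p : ℚ)) (Or.inr rfl) C hC)

/-- **The `p ∣ #Ш_an` rows: `BSD(E,p)` from ONE finite certificate** (X3 ∧ `r_an = 0` ∧ (semistable
twist), `p ≡ 3 (mod 4)`). If `#Ш_an(E) = q` with `ord_p q ≤ 2k` and `p^{2k−1} ∣ #Ш(E)` (for
`k = 1`: `Ш(E)[p] ≠ 0`, a `p`-descent certificate), then `BSD(E,p)`: the upper half is
`missingUpperBoundAt_of_semistableTwist` (granted [B∘C](0)), the lower half is Cassels–Tate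
squareness (`hCT` = bsd.S18, `missingLowerBoundAt_of_casselsTate_of_pow_dvd`). Census (harvest-2 R6
(1)): the 5 rank-0 V9 rows with `p ∣ #Ш_an` are `7632m1, 8190bz1, 13860x1, 15138i1, 19530cg1` at
`p = 3`, all with `#Ш_an = 9` (`k = 1`). [cite: SilvermanAEC2009, Thm. X.4.14]
[cite: Miller2011LMS, §1 and Def. 1.1] -/
theorem X3RankZeroTwistOdd.bsdp_of_semistableTwist_of_casselsTate_of_pow_dvd
    (hDel : Delbourgo1998.prop4_rankZero_pow_dvd_constantCoeff)
    (hGZK : rank_eq_analyticRank_of_analyticRank_le_one) (hmod : hasEntireLFunction_rat)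
    (hCT : exists_casselsTate_pairing (K := ℚ)) (hBC : ChiBranchLeadingTermOddAt W p)
    (hp4 : p % 4 = 3) (hr : W.analyticRank = 0) (hX : ClassX3 W p)
    (V : WeierstrassCurve ℚ) [V.IsElliptic] [V.IsGloballyMinimal]
    (C : VariableChange ℚ) (hC : C • V.quadraticTwist (-(p : ℚ)) = W) (hV : GoodOrd V p ∨ Mult V p)
    {N : ℕ} [NeZero N] {f : CuspForm (Gamma0 N) 2} (hf : IsNewformOf V f)
    (ϖ : ℚ) (hϖ : (ϖ : ℝ) * V.imaginaryPeriodRat = minusPeriod f)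
    {q : ℚ} (hq : shaAn W = (q : ℂ)) {k : ℕ} (hv : padicValRat p q ≤ 2 * k)
    (hdvd : p ^ (2 * k - 1) ∣ W.shaOrder) : BSDp W p :=
  bsdp_of_missingPPartAt W p hGZK (by rw [hr]; exact zero_le_one)
    (missingPPartAt_of_lower_of_upper W p
      (missingLowerBoundAt_of_casselsTate_of_pow_dvd W p hCT (hGZK W (by rw [hr]; exact zero_le_one)).2
        hq hv hdvd)
      (X3RankZeroTwistOdd.missingUpperBoundAt_of_semistableTwist W p hDel hGZK hmod hBC hp4 hr hX V C
        hC hV hf ϖ hϖ))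

end X3Odd

/-! ## X4 (big image), `p ≡ 3 (mod 4)` -/

section X4Odd

/-- **`ord_p #Ш(E) ≤ ord_p #Ш_an(E)` on X4 ∧ `r_an = 0` ∧ (semistable big-image twist),
`p ≡ 3 (mod 4)`, `p = 3` INCLUDED**, granted the Kato-shaped typed input: the "≤" half of X4♯(3) on
the semistable-twist rows with NO per-pair Tamagawa bit. -/
theorem X4RankZeroTwistOdd.padicValNat_shaOrder_le_shaAn
    (hDel : Delbourgo1998.prop4_rankZero_pow_dvd_constantCoeff)
    (hGZK : rank_eq_analyticRank_of_analyticRank_le_one) (hmod : hasEntireLFunction_rat)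
    (hBC : ChiBranchLeadingTermOddBigImageAt W p)
    (hp4 : p % 4 = 3) (hr : W.analyticRank = 0) (hX : ClassX4 W p)
    (V : WeierstrassCurve ℚ) [V.IsElliptic] [V.IsGloballyMinimal]
    (C : VariableChange ℚ) (hC : C • V.quadraticTwist (-(p : ℚ)) = W) (hV : GoodOrd V p ∨ Mult V p)
    (hsurj : ∀ n : ℕ, V.HasSurjectiveModNGaloisRep (p ^ n : ℕ))
    {N : ℕ} [NeZero N] {f : CuspForm (Gamma0 N) 2} (hf : IsNewformOf V f)
    (ϖ : ℚ) (hϖ : (ϖ : ℝ) * V.imaginaryPeriodRat = minusPeriod f) :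
    ∃ q : ℚ, shaAn W = (q : ℂ) ∧ (padicValNat p W.shaOrder : ℤ) ≤ padicValRat p q := by
  obtain ⟨q, hq, hle⟩ :=
    X4RankZeroTwistOdd.shaOrder_le W p hDel hGZK hmod hBC hp4 hr hX V C hC hV hsurj hf ϖ hϖ
  have htam := not_dvd_tamagawaNumberAt_twist_pm_p p (by omega) V
    (hV.elim (fun h ↦ Or.inl h.1) Or.inr) (d := -(p : ℚ)) (Or.inr rfl) C hC
  refine ⟨q, hq, ?_⟩
  rw [padicValNat.eq_zero_of_not_dvd htam, Nat.cast_zero, add_zero] at hle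
  exact hle

/-- **`Typed.MissingUpperBoundAt W p` on X4 ∧ `r_an = 0` ∧ (semistable big-image twist) at every
`p ≡ 3 (mod 4)`** (no Tamagawa hypothesis), granted the Kato-shaped typed input. -/
theorem X4RankZeroTwistOdd.missingUpperBoundAt_of_semistableTwist
    (hDel : Delbourgo1998.prop4_rankZero_pow_dvd_constantCoeff)
    (hGZK : rank_eq_analyticRank_of_analyticRank_le_one) (hmod : hasEntireLFunction_rat)
    (hBC : ChiBranchLeadingTermOddBigImageAt W p)
    (hp4 : p % 4 = 3) (hr : W.analyticRank = 0) (hX : ClassX4 W p)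
    (V : WeierstrassCurve ℚ) [V.IsElliptic] [V.IsGloballyMinimal]
    (C : VariableChange ℚ) (hC : C • V.quadraticTwist (-(p : ℚ)) = W) (hV : GoodOrd V p ∨ Mult V p)
    (hsurj : ∀ n : ℕ, V.HasSurjectiveModNGaloisRep (p ^ n : ℕ))
    {N : ℕ} [NeZero N] {f : CuspForm (Gamma0 N) 2} (hf : IsNewformOf V f)
    (ϖ : ℚ) (hϖ : (ϖ : ℝ) * V.imaginaryPeriodRat = minusPeriod f) :
    MissingUpperBoundAt W p :=
  X4RankZeroTwistOdd.missingUpperBoundAt W p hDel hGZK hmod hBC hp4 hr hX V C hC hV hsurj hf ϖ hϖ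
    (not_dvd_tamagawaNumberAt_twist_pm_p p (by omega) V (hV.elim (fun h ↦ Or.inl h.1) Or.inr)
      (d := -(p : ℚ)) (Or.inr rfl) C hC)

/-- **`BSD(E,p)` on the `p ∤ #Ш_an(E)` rows of X4 ∧ `r_an = 0` ∧ (semistable big-image twist),
`p ≡ 3 (mod 4)` — `BSD(E,3)` included** — granted the Kato-shaped typed input; no Kurihara number,
no Manin hypothesis, no Tamagawa bit. -/
theorem X4RankZeroTwistOdd.bsdp_of_semistableTwist_of_shaAn_unit
    (hDel : Delbourgo1998.prop4_rankZero_pow_dvd_constantCoeff)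
    (hGZK : rank_eq_analyticRank_of_analyticRank_le_one) (hmod : hasEntireLFunction_rat)
    (hBC : ChiBranchLeadingTermOddBigImageAt W p)
    (hp4 : p % 4 = 3) (hr : W.analyticRank = 0) (hX : ClassX4 W p)
    (V : WeierstrassCurve ℚ) [V.IsElliptic] [V.IsGloballyMinimal]
    (C : VariableChange ℚ) (hC : C • V.quadraticTwist (-(p : ℚ)) = W) (hV : GoodOrd V p ∨ Mult V p)
    (hsurj : ∀ n : ℕ, V.HasSurjectiveModNGaloisRep (p ^ n : ℕ))
    {N : ℕ} [NeZero N] {f : CuspForm (Gamma0 N) 2} (hf : IsNewformOf V f)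
    (ϖ : ℚ) (hϖ : (ϖ : ℝ) * V.imaginaryPeriodRat = minusPeriod f)
    {q : ℚ} (hq : shaAn W = (q : ℂ)) (hv : padicValRat p q = 0) : BSDp W p :=
  X4RankZeroTwistOdd.bsdp_of_shaAn_unit W p hDel hGZK hmod hBC hp4 hr hX V C hC hV hsurj hf ϖ hϖ
    (not_dvd_tamagawaNumberAt_twist_pm_p p (by omega) V (hV.elim (fun h ↦ Or.inl h.1) Or.inr)
      (d := -(p : ℚ)) (Or.inr rfl) C hC) hq hv

/-- **What remains of X4♯ on these pairs is exactly the LOWER half** (`p ≡ 3 (mod 4)`, no Tamagawa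
hypothesis), granted the Kato-shaped typed input: `Typed.X4.MissingInputAt W p ⟺ MissingLowerBoundAt W p`. -/
theorem X4RankZeroTwistOdd.missingPPartAt_iff_lower_of_semistableTwist
    (hDel : Delbourgo1998.prop4_rankZero_pow_dvd_constantCoeff)
    (hGZK : rank_eq_analyticRank_of_analyticRank_le_one) (hmod : hasEntireLFunction_rat)
    (hBC : ChiBranchLeadingTermOddBigImageAt W p)
    (hp4 : p % 4 = 3) (hr : W.analyticRank = 0) (hX : ClassX4 W p)
    (V : WeierstrassCurve ℚ) [V.IsElliptic] [V.IsGloballyMinimal]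
    (C : VariableChange ℚ) (hC : C • V.quadraticTwist (-(p : ℚ)) = W) (hV : GoodOrd V p ∨ Mult V p)
    (hsurj : ∀ n : ℕ, V.HasSurjectiveModNGaloisRep (p ^ n : ℕ))
    {N : ℕ} [NeZero N] {f : CuspForm (Gamma0 N) 2} (hf : IsNewformOf V f)
    (ϖ : ℚ) (hϖ : (ϖ : ℝ) * V.imaginaryPeriodRat = minusPeriod f) :
    X4.MissingInputAt W p ↔ MissingLowerBoundAt W p :=
  X4RankZeroTwistOdd.missingPPartAt_iff_lower W p hDel hGZK hmod hBC hp4 hr hX V C hC hV hsurj hf ϖ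
    hϖ (not_dvd_tamagawaNumberAt_twist_pm_p p (by omega) V (hV.elim (fun h ↦ Or.inl h.1) Or.inr)
      (d := -(p : ℚ)) (Or.inr rfl) C hC)

/-- **The `p ∣ #Ш_an` rows of X4 at `p ≡ 3 (mod 4)`: `BSD(E,p)` from ONE finite certificate**
(`ord_p #Ш_an ≤ 2k` and `p^{2k−1} ∣ #Ш(E)`), granted the Kato-shaped typed input; upper half
`missingUpperBoundAt_of_semistableTwist`, lower half Cassels–Tate squareness (`hCT`).
[cite: SilvermanAEC2009, Thm. X.4.14] [cite: Miller2011LMS, §1 and Def. 1.1] -/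
theorem X4RankZeroTwistOdd.bsdp_of_semistableTwist_of_casselsTate_of_pow_dvd
    (hDel : Delbourgo1998.prop4_rankZero_pow_dvd_constantCoeff)
    (hGZK : rank_eq_analyticRank_of_analyticRank_le_one) (hmod : hasEntireLFunction_rat)
    (hCT : exists_casselsTate_pairing (K := ℚ)) (hBC : ChiBranchLeadingTermOddBigImageAt W p)
    (hp4 : p % 4 = 3) (hr : W.analyticRank = 0) (hX : ClassX4 W p)
    (V : WeierstrassCurve ℚ) [V.IsElliptic] [V.IsGloballyMinimal]
    (C : VariableChange ℚ) (hC : C • V.quadraticTwist (-(p : ℚ)) = W) (hV : GoodOrd V p ∨ Mult V p)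
    (hsurj : ∀ n : ℕ, V.HasSurjectiveModNGaloisRep (p ^ n : ℕ))
    {N : ℕ} [NeZero N] {f : CuspForm (Gamma0 N) 2} (hf : IsNewformOf V f)
    (ϖ : ℚ) (hϖ : (ϖ : ℝ) * V.imaginaryPeriodRat = minusPeriod f)
    {q : ℚ} (hq : shaAn W = (q : ℂ)) {k : ℕ} (hv : padicValRat p q ≤ 2 * k)
    (hdvd : p ^ (2 * k - 1) ∣ W.shaOrder) : BSDp W p :=
  bsdp_of_missingPPartAt W p hGZK (by rw [hr]; exact zero_le_one)
    (missingPPartAt_of_lower_of_upper W p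
      (missingLowerBoundAt_of_casselsTate_of_pow_dvd W p hCT (hGZK W (by rw [hr]; exact zero_le_one)).2
        hq hv hdvd)
      (X4RankZeroTwistOdd.missingUpperBoundAt_of_semistableTwist W p hDel hGZK hmod hBC hp4 hr hX V C
        hC hV hsurj hf ϖ hϖ))

end X4Odd

/-! ## X3, every odd prime (both parities glued) -/

section AnyOdd

/-- **`ord_p #Ш(E) ≤ ord_p #Ш_an(E)` for every odd prime on X3 ∧ `r_an = 0` ∧
(`E ≅ V^{(p*)}`, `V` good ordinary or multiplicative at `p`)**, granted the typed inputs of both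
parities (only the relevant one is used); no Tamagawa hypothesis. -/
theorem X3RankZeroTwist.padicValNat_shaOrder_le_shaAn_of_odd_prime
    (hDel : Delbourgo1998.prop4_rankZero_pow_dvd_constantCoeff)
    (hGZK : rank_eq_analyticRank_of_analyticRank_le_one) (hmod : hasEntireLFunction_rat)
    (hBCeven : ChiBranchLeadingTermAt W p) (hBCodd : ChiBranchLeadingTermOddAt W p)
    (hp2 : p ≠ 2) (hr : W.analyticRank = 0) (hX : ClassX3 W p)
    (V : WeierstrassCurve ℚ) [V.IsElliptic] [V.IsGloballyMinimal]
    (C : VariableChange ℚ) (hC : C • V.quadraticTwist ((-1 : ℚ) ^ (p / 2) * p) = W)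
    (hV : GoodOrd V p ∨ Mult V p)
    {N : ℕ} [NeZero N] {f : CuspForm (Gamma0 N) 2} (hf : IsNewformOf V f)
    (ϖp : ℚ) (hϖp : (ϖp : ℝ) * V.realPeriodRat = plusPeriod f)
    (ϖm : ℚ) (hϖm : (ϖm : ℝ) * V.imaginaryPeriodRat = minusPeriod f) :
    ∃ q : ℚ, shaAn W = (q : ℂ) ∧ (padicValNat p W.shaOrder : ℤ) ≤ padicValRat p q := by
  obtain ⟨q, hq, hle⟩ := X3RankZeroTwist.shaOrder_le_of_odd_prime W p hDel hGZK hmod hBCeven hBCodd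
    hp2 hr hX V C hC hV hf ϖp hϖp ϖm hϖm
  have hodd : p % 4 = 1 ∨ p % 4 = 3 := by
    obtain ⟨k, hk⟩ := hp.out.odd_of_ne_two hp2
    omega
  have hd : ((-1 : ℚ) ^ (p / 2) * p) = p ∨ ((-1 : ℚ) ^ (p / 2) * p) = -p := by
    rw [pStar_eq_of_mod_four p hodd]
    split_ifs
    · exact Or.inl rfl
    · exact Or.inr rfl
  have htam := not_dvd_tamagawaNumberAt_twist_pm_p p hp2 V (hV.elim (fun h ↦ Or.inl h.1) Or.inr)
    hd C hC
  refine ⟨q, hq, ?_⟩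
  rw [padicValNat.eq_zero_of_not_dvd htam, Nat.cast_zero, add_zero] at hle
  exact hle

/-- **`Typed.MissingUpperBoundAt W p` for every odd prime on X3 ∧ `r_an = 0` ∧ (semistable twist
by `p*`)**, granted the typed inputs; no Tamagawa hypothesis. -/
theorem X3RankZeroTwist.missingUpperBoundAt_of_odd_prime_of_semistableTwist
    (hDel : Delbourgo1998.prop4_rankZero_pow_dvd_constantCoeff)
    (hGZK : rank_eq_analyticRank_of_analyticRank_le_one) (hmod : hasEntireLFunction_rat)
    (hBCeven : ChiBranchLeadingTermAt W p) (hBCodd : ChiBranchLeadingTermOddAt W p)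
    (hp2 : p ≠ 2) (hr : W.analyticRank = 0) (hX : ClassX3 W p)
    (V : WeierstrassCurve ℚ) [V.IsElliptic] [V.IsGloballyMinimal]
    (C : VariableChange ℚ) (hC : C • V.quadraticTwist ((-1 : ℚ) ^ (p / 2) * p) = W)
    (hV : GoodOrd V p ∨ Mult V p)
    {N : ℕ} [NeZero N] {f : CuspForm (Gamma0 N) 2} (hf : IsNewformOf V f)
    (ϖp : ℚ) (hϖp : (ϖp : ℝ) * V.realPeriodRat = plusPeriod f)
    (ϖm : ℚ) (hϖm : (ϖm : ℝ) * V.imaginaryPeriodRat = minusPeriod f) :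
    MissingUpperBoundAt W p := by
  obtain ⟨q, hq, hle⟩ := X3RankZeroTwist.padicValNat_shaOrder_le_shaAn_of_odd_prime W p hDel hGZK hmod
    hBCeven hBCodd hp2 hr hX V C hC hV hf ϖp hϖp ϖm hϖm
  exact ⟨q, hq, hle⟩

/-- **`BSD(E,p)` for every odd prime on the `p ∤ #Ш_an(E)` rows of X3 ∧ `r_an = 0` ∧ (semistable
twist by `p*`)**, granted the typed inputs; the only per-pair datum is `p ∤ #Ш_an(E)`. -/
theorem X3RankZeroTwist.bsdp_of_odd_prime_of_semistableTwist_of_shaAn_unit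
    (hDel : Delbourgo1998.prop4_rankZero_pow_dvd_constantCoeff)
    (hGZK : rank_eq_analyticRank_of_analyticRank_le_one) (hmod : hasEntireLFunction_rat)
    (hBCeven : ChiBranchLeadingTermAt W p) (hBCodd : ChiBranchLeadingTermOddAt W p)
    (hp2 : p ≠ 2) (hr : W.analyticRank = 0) (hX : ClassX3 W p)
    (V : WeierstrassCurve ℚ) [V.IsElliptic] [V.IsGloballyMinimal]
    (C : VariableChange ℚ) (hC : C • V.quadraticTwist ((-1 : ℚ) ^ (p / 2) * p) = W)
    (hV : GoodOrd V p ∨ Mult V p)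
    {N : ℕ} [NeZero N] {f : CuspForm (Gamma0 N) 2} (hf : IsNewformOf V f)
    (ϖp : ℚ) (hϖp : (ϖp : ℝ) * V.realPeriodRat = plusPeriod f)
    (ϖm : ℚ) (hϖm : (ϖm : ℝ) * V.imaginaryPeriodRat = minusPeriod f)
    {q : ℚ} (hq : shaAn W = (q : ℂ)) (hv : padicValRat p q = 0) : BSDp W p :=
  bsdp_of_missingPPartAt W p hGZK (by rw [hr]; exact zero_le_one)
    (missingPPartAt_of_upper_of_shaAn_unit W p
      (X3RankZeroTwist.missingUpperBoundAt_of_odd_prime_of_semistableTwist W p hDel hGZK hmod hBCeven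
        hBCodd hp2 hr hX V C hC hV hf ϖp hϖp ϖm hϖm) hq hv)

end AnyOdd

end Summit.BirchSwinnertonDyer.Rank1Residual.Additive

end
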